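import Summits.BirchSwinnertonDyer.BirchSwinnertonDyer.Theses.LeadingTerm
import Summits.BirchSwinnertonDyer.BirchSwinnertonDyer.Theorems.TamePinch.Negative.CMQuarticImage
import Summits.BirchSwinnertonDyer.BirchSwinnertonDyer.Theorems.TamePinchR.Negative.ConsequencesOfCrux
import Summits.BirchSwinnertonDyer.BirchSwinnertonDyer.Theorems.TamePinchR.Negative.NonCMLoadBearing
import Summits.BirchSwinnertonDyer.BirchSwinnertonDyer.Theorems.TamePinchR.Negative.PinchPrimeUnbounded
import Summits.BirchSwinnertonDyer.BirchSwinnertonDyer.Theorems.TamePinchR.Negative.IsogenyPrimeInadmissible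
import Literature.NumberTheory.EllipticCurves.ComplexMultiplicationRationalJIntegralProofs
import Literature.NumberTheory.EllipticCurves.SzpiroLocalDataProofs
import Literature.NumberTheory.EllipticCurves.DegreeConjectureAbcPrelims
import Literature.NumberTheory.EllipticCurves.RootNumberProofs
import Literature.NumberTheory.EllipticCurves.QuadraticTwistKroneckerLFunctionProofs

/-!
# Disproof of `TamePinchR` (crux stmt-BirchSwinnertonDyer-17007, route `LeadingTerm`) — findings

Standing disprover `refuter-cdisprove-stmt-BirchSwinnertonDyer-17007-0`, cycle 1 (2026-08-16).
VERDICT OF THE CYCLE: **no kill; the crux resists** (open-problem grade). Everything below is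
kernel-checked unless marked NEAR-MISS (`sorry`, §5 only).

## Index

* §0 `Certificate`, `tamePinchR_iff` — the crux factored as
  `∀ W elliptic globally-minimal, ¬CM → ∃ p ≥ 5, Certificate W p` (`Iff.rfl`).
* §1 LOAD-BEARING (a): `TamePinchRWithoutNonCM`, `tamePinchR_false_without_nonCM` (LANDED
  `Negative/NonCMLoadBearing.lean`, p130920) — dropping `¬ W.HasCM` gives back the refuted parent
  `TamePinch`: 32a2 = `[0,0,0,−1,0]` (CM by `ℤ[i]`) has no odd prime of surjective mod-`p` image.
  ANY PROOF MUST USE `¬ W.HasCM` (it enters exactly once: Serre's open image ⇒ cofinitely many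
  surjective `p`). §1b (LANDED `Negative/IsogenyPrimeInadmissible.lean`, p131456): rational
  odd-order torsion ⇒ inadmissible; 11a3 (non-CM, good at 5) has `ρ̄_5` not onto, so the crux's
  prime at 11a3 is `≥ 7` — the `∃ p` also dodges the isogeny primes of non-CM curves.
  The other two hypotheses (`IsElliptic`, `IsGloballyMinimal`) are typing prerequisites of
  `frobeniusTrace` / `IsOrdinaryAt` and cannot be dropped from the signature; no junk-model attack
  through singular "globally minimal" cubics was attempted (their `HasCM` is junk-land).
* §2 the family `W_b = [1,0,0,0,b] : y² + xy = x³ + b` (LANDED `Negative/PinchPrimeUnbounded.lean`,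
  p130969) — `c₄ = 1`, `Δ = −b(1+432b)`; for every integer `b ≠ 0`: elliptic, GLOBALLY MINIMAL
  (`c₄` a unit at every prime), bad at every `p ∣ b`, and NON-CM when `2 ∣ b` (`‖j‖₂ = ‖b‖₂⁻¹ > 1`).
  A cheap supply of non-CM curves with prescribed bad primes (explicit inhabitants of the binder).
* §3 STRENGTHENINGS REFUTED (c) (LANDED, same file): `not_tamePinchR_bounded` — for every `B`, some
  non-CM curve (`W_{2·B!}`) has NO admissible prime `p ≤ B`; `not_tamePinchR_uniform` — no prime
  serves all curves (`∃ p ∀ W` is false). So the `∃ p` is genuinely curve-dependent and cannot be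
  bounded by any absolute constant: a proof must produce `p` from the arithmetic of `W` (at least
  from its conductor), never from a finite search.
* §4 TARGETS / LINE `Sketch` — no stuck stubs yet; refuter pass over the lead's six stubs
  (`Lines/Sketch.lean`): A, B, C, D TRUE and provable from the tree, K faithful to Kim 2022 Thm 1.11
  (IMC at good ordinary surjective `p ≥ 5` by Kato + Skinner–Urban + Wan), M = tree fact; joint
  sufficiency kernel-checked; the line is exactly the slice `ShaFiniteConjecture ⇒ TamePinchR`.
* §5 NEAR-MISSES (sorried, NOT landable): `not_tamePinchR_fixedPrime` — the `∀ admissible p` form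
  is false in print (1058.e1 at `p = 5`, Kim 2022 §8: rank 0, `δ₁ = L(E,1)/Ω⁺ = 25 ≡ 0`,
  `Ш[5^∞] ≅ (ℤ/5)²`); `not_tamePinchR_forallLevels` — the `∀ n` form is false (37a1, `p = 5`:
  `δ_211 ≡ 0` while `δ_61 ≡ 1`, kit job j020465 of the crux-attack seat; in general `δ_ℓ = 0`
  whenever the generator reduces into `p·E(𝔽_ℓ)`). Obstruction to closing either in Lean: the tree
  has no evaluator for `ratPlusSymbol` / `L(E,1)` / `mordellWeilRank` / `Ш`, and SURJECTIVITY of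
  `ρ̄_{E,p}` is not provable for a single explicit `(E,p)` with the present API (only its failure is:
  CM, rational isogeny) — so every Lean-checkable negative statement about this crux has to go
  through INADMISSIBILITY of primes (§1, §3), never through the Kurihara certificate itself.

## Why the crux resists (briefing for provers and ideators)

1. SANDWICH. By Kim 2022 (arXiv:2203.12159) Thm 1.11 + Cor 1.14, at an admissible `p` (good,
   `p ≥ 5`, `ρ̄` onto, non-anomalous `a_p ≢ 1`, `p ∤ Tam(E)`, IMC at `p` — a theorem there) the
   certificate `∃ n, ν(n) = rank ∧ δ_n ≢ 0` holds IFF `Ш(E)[p] = 0`. Hence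
   `[Ш(E) finite for every non-CM E/ℚ] + Kim + IMC + modularity + Serre/Chebotarev ⟹ TamePinchR`
   and `TamePinchR ⟹ [every non-CM E has Ш(E)[p] = 0 and Sel_p-corank = rank at SOME admissible p]`
   (Kim Cor 1.14), `⟹ MW-parity (−1)^rank = w(E)` for every non-CM `E` (UNCONDITIONALLY in the
   crux alone: the Mazur–Tate functional equation `w(E)·(−1)^{ν(n)}·δ_n = δ_n`, Kim §3.5 PDF p. 19,
   forces `δ_n = 0` unless `(−1)^{ν(n)} = w(E)`, and the crux has `ν(n) = rank`, `δ_n ≠ 0`) and the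
   rank-0 converse `rank 0 ⇒ L(E,1) ≠ 0` for non-CM curves (landed
   `Negative.ratPlusSymbol_zero_ne_zero_of_tamePinchR`). So ANY proof of the crux proves the
   Mordell–Weil parity conjecture for all non-CM curves over `ℚ` — calibrate expectations there. A counterexample
   is therefore a non-CM curve with `Ш(E)[p] ≠ 0` at EVERY admissible `p` — it would exhibit an
   infinite `Ш` (no such curve is known or expected); a proof needs `Ш(E)[p] = 0` at ONE admissible
   `p` for every non-CM curve of rank ≥ 2 — open (known for `r_an ≤ 1` only, Kolyvagin). Nothing
   cheaper than one of these two can decide the crux.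
2. TYPING AUDIT (all honest, no junk bites): `HasSurjectiveModNGaloisRep p` = `ρ̄` onto
   `AddAut(E[p]) = GL₂(𝔽_p)`; `IsOrdinaryAt` = good ∧ `p ∤ a_p` with `a_p = p + 1 − #Ẽ(𝔽_p)`
   INCLUDING `O` (so `a_ℓ ≡ 2, ℓ ≡ 1` is exactly Kim's `𝒫₁`); `IsNewformOf` = normalised newform
   with `a_n(f) = a_n(W)` (isogeny-invariant — the symbol is normalised by `Ω⁺_f`, not `Ω⁺_W`: the
   ratio is a `p`-unit at admissible `p` since `ρ̄` onto ⇒ no `p`-isogeny in the class and `p` good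
   odd ⇒ `p ∤` Manin constant); the `ℚ → ZMod p` cast is junk `0` when `p ∣ den`, which cannot
   happen at admissible `p` (`IsNewformOf.not_dvd_den_ratPlusSymbol_div`); `ψ`-choice is immaterial
   (`kuriharaNumber_eq_zero_iff_of_surjective`); rank 0 forces `n = 1` (`Negative.kuriharaSum_one`).
3. WHAT IS LOAD-BEARING INSIDE THE `∃`: the prime must avoid (i) bad primes (§3: unboundedly many),
   (ii) non-surjective primes (§1: all of them for CM; finitely many otherwise, Serre), (iii) the
   primes dividing `#Ш_an·Tam` (§5: 1058.e1 @ 5) — three finite-but-unbounded exceptional sets; and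
   the level `n` must be chosen, not quantified (§5). Any line that fixes `p` before seeing `W`, or
   bounds it, or claims all Kolyvagin levels work, is refuted here.
-/

noncomputable section

-- D-0017: single-problem summit, `Summit.BirchSwinnertonDyer.BirchSwinnertonDyer.…` repeats a
-- namespace by design.
set_option linter.dupNamespace false

namespace Summit.BirchSwinnertonDyer.BirchSwinnertonDyer.Cruxes.TamePinchR.Disproof

open scoped MatrixGroups ModularForm
open CongruenceSubgroup IsDedekindDomain
open Literature.NumberTheory.EllipticCurves Literature.NumberTheory.EllipticCurves.ModularForms
open Summit.BirchSwinnertonDyer.BirchSwinnertonDyer.Theses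
open WeierstrassCurve

/-! ## 0. The crux, factored: `TamePinchR ↔ ∀ W, ¬CM → ∃ p ≥ 5, Certificate W p` -/

/-- The conclusion of `TamePinchR` at a curve `W` and a prime `p` (everything after `5 ≤ p ∧`):
`p` is admissible (good ordinary, `ρ̄_{W,p}` onto) and carries a newform `f` of `W`, a square-free
product `n` of `rank_ℤ W(ℚ)` Kolyvagin primes and surjective discrete logarithms `ψ_ℓ` with
non-zero mod-`p` Kurihara number `δ_n`. Verbatim the body of the route decl. [folklore] -/
def Certificate (W : WeierstrassCurve ℚ) [W.IsGloballyMinimal] (p : ℕ) [Fact p.Prime] : Prop :=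
  Literature.NumberTheory.EllipticCurves.IsOrdinaryAt W p ∧ W.HasSurjectiveModNGaloisRep (p : ℤ) ∧
    ∃ (N : ℕ) (_ : NeZero N) (f : CuspForm (CongruenceSubgroup.Gamma0 N) 2),
      Literature.NumberTheory.EllipticCurves.ModularForms.IsNewformOf W f ∧
      ∃ (n : ℕ) (_ : NeZero n), Squarefree n ∧ n.primeFactors.card = W.mordellWeilRank ∧
        (∀ ℓ ∈ n.primeFactors, ¬ ℓ ∣ N * p ∧ (ℓ : ZMod p) = 1 ∧ (W.frobeniusTrace ℓ : ZMod p) = 2) ∧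
        ∃ ψ : (ℓ : ℕ) → (ZMod ℓ)ˣ →* Multiplicative (ZMod p),
          (∀ ℓ ∈ n.primeFactors, Function.Surjective (ψ ℓ)) ∧
          (∑ a : (ZMod n)ˣ, (Literature.NumberTheory.EllipticCurves.ratPlusSymbol f
              (((a : ZMod n).val : ℚ) / n) : ZMod p) *
            ∏ ℓ ∈ n.primeFactors.attach, Multiplicative.toAdd
              (ψ ℓ.1 (ZMod.unitsMap (Nat.dvd_of_mem_primeFactors ℓ.2) a))) ≠ 0

/-- `TamePinchR` is literally `∀ W elliptic globally minimal, ¬ W.HasCM → ∃ p ≥ 5 prime,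
Certificate W p`. [folklore] -/
theorem tamePinchR_iff :
    LeadingTerm.TamePinchR ↔ ∀ (W : WeierstrassCurve ℚ) [W.IsElliptic] [W.IsGloballyMinimal],
      ¬ W.HasCM → ∃ (p : ℕ) (_ : Fact p.Prime), 5 ≤ p ∧ Certificate W p :=
  Iff.rfl

/-! ## 1. Load-bearing hypotheses (a): `¬ W.HasCM` -/

/-- `TamePinchR` with the hypothesis `¬ W.HasCM` dropped (= the refuted parent `TamePinch`,
stmt-BirchSwinnertonDyer-15532). [folklore] -/
def TamePinchRWithoutNonCM : Prop :=
  ∀ (W : WeierstrassCurve ℚ) [W.IsElliptic] [W.IsGloballyMinimal],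
    ∃ (p : ℕ) (_ : Fact p.Prime), 5 ≤ p ∧ Certificate W p

/-- **Any proof of `TamePinchR` must use `¬ W.HasCM`.** Without it the statement is false: the CM
curve `y² = x³ − x` (Cremona 32a2, `[0,0,0,−1,0]`, globally minimal) has no prime `p ≥ 5` — indeed
no odd prime — with `ρ̄_{W,p}` onto (landed negative lemma
`Theorems.tamePinch_not_hasSurjectiveModNGaloisRep_quartic`, Serre 1972 §4.5 / Zywina 2015
Prop. 1.14), so the admissible-prime clause of the certificate already fails. [folklore] -/
theorem tamePinchR_false_without_nonCM : ¬ TamePinchRWithoutNonCM :=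
  -- landed: `Theorems/TamePinchR/Negative/NonCMLoadBearing.lean` (p130920), same statement inlined
  Theorems.TamePinchR.Negative.tamePinchR_false_without_nonCM

/-! ## 1b. Load-bearing INSIDE the `∃ p`: admissibility also excludes the isogeny primes of
NON-CM curves (LANDED `Theorems/TamePinchR/Negative/IsogenyPrimeInadmissible.lean`, p131456) -/

/-- **Rational odd-order torsion makes a prime inadmissible** (alias of the landed
`Negative.not_hasSurjectiveModNGaloisRep_of_zsmul_eq_zero`): `0 ≠ P ∈ E(ℚ)`, `p·P = 0`, `p` odd
⇒ `ρ̄_{E,p}` is not onto (base-change `P` to `ℚ(ζ₃)` and use the tree's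
`torsionBy_eq_bot_of_hasSurjectiveModNGaloisRep`, Gross 1991 §2). A refuter's tool: any stub
asserting admissibility of a specific small prime at a specific curve dies on a rational torsion
point. [folklore] -/
theorem inadmissible_of_rational_torsion (W : WeierstrassCurve ℚ) [W.IsElliptic] {p : ℕ}
    (hp : p.Prime) (hp2 : p ≠ 2) (P : (W.baseChange ℚ).toAffine.Point) (hP0 : P ≠ 0)
    (hP : (p : ℤ) • P = 0) : ¬ W.HasSurjectiveModNGaloisRep p :=
  Theorems.TamePinchR.Negative.not_hasSurjectiveModNGaloisRep_of_zsmul_eq_zero W hp hp2 P hP0 hP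

/-- **11a3** (`[0,−1,1,0,0]`, `y² + y = x³ − x²`: elliptic, globally minimal, NON-CM, good
reduction at 5) has `ρ̄_5` NOT onto — `(0,0)` is a rational point of order 5 (landed:
`elevenA3_exists_five_torsion`, explicit chord–tangent computation `2P = (1,−1)`,
`2P + P = (1,0) = −2P`). [folklore] -/
theorem elevenA3_inadmissible_five :
    ¬ (⟨0, -1, 1, 0, 0⟩ : WeierstrassCurve ℚ).HasSurjectiveModNGaloisRep ((5 : ℕ) : ℤ) :=
  Theorems.TamePinchR.Negative.elevenA3_not_hasSurjectiveModNGaloisRep_five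

/-- Hence **the prime the crux produces at 11a3 is `≥ 7`**: the `∃ p` provably skips the isogeny
prime `5` of a non-CM curve although `5` is a good prime there — exceptional set (ii) of the module
docstring is non-empty for non-CM curves too (finite by Serre 1972; by Mazur 1978 the rational
torsion primes are `≤ 7`). Numerically (kit j020795, PARI `msfromell`): the Néron-normalised
`[0]⁺` of the three curves 11a1/11a2/11a3 sharing ONE newform is `1/5`, `1`, `1/25` — the spread
`5^{±1}` between Kim's normalisation and the tree's single `Ω⁺_f`-normalised value sits exactly at
this inadmissible prime, as the module docstring's typing audit predicts. [folklore] -/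
theorem tamePinchR_prime_at_elevenA3 (h : LeadingTerm.TamePinchR) :
    ∃ (p : ℕ) (_ : Fact p.Prime), 7 ≤ p ∧
      @Literature.NumberTheory.EllipticCurves.IsOrdinaryAt (⟨0, -1, 1, 0, 0⟩ : WeierstrassCurve ℚ)
        Theorems.TamePinchR.Negative.isGloballyMinimal_elevenA3 p _ ∧
      (⟨0, -1, 1, 0, 0⟩ : WeierstrassCurve ℚ).HasSurjectiveModNGaloisRep (p : ℤ) :=
  Theorems.TamePinchR.Negative.seven_le_of_tamePinchR_elevenA3 h

/-! ## 2. The family `W_b : y² + xy = x³ + b` (`c₄ = 1`): non-CM curves with prescribed bad primes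
(landed: `Theorems/TamePinchR/Negative/PinchPrimeUnbounded.lean`, p130969 — `family_int_Δ`,
`family_int_c₄`, `family_Δ`, `family_c₄`, `family_baseChange`, `family_isElliptic`,
`family_isMinimalAt`, `family_isGloballyMinimal`, `family_not_hasGoodReductionAtPrime`,
`family_not_hasCM`, `family_inhabits_binder`) -/

/-- NON-VACUITY SUPPLY (alias of the landed `Negative.family_inhabits_binder`): for every even
integer `b ≠ 0`, `W_b = [1,0,0,0,b]` is elliptic, globally minimal and non-CM, and is bad at
every prime factor of `b`. (`b = 1` gives 433a1, the rank-2 curve `y² + xy = x³ + 1`.) [folklore] -/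
theorem family_inhabits_binder (b : ℤ) (hb : b ≠ 0) (h2 : (2 : ℤ) ∣ b) :
    ∃ (_ : (⟨1, 0, 0, 0, (b : ℚ)⟩ : WeierstrassCurve ℚ).IsElliptic)
      (_ : (⟨1, 0, 0, 0, (b : ℚ)⟩ : WeierstrassCurve ℚ).IsGloballyMinimal),
      ¬ (⟨1, 0, 0, 0, (b : ℚ)⟩ : WeierstrassCurve ℚ).HasCM ∧
        ∀ (p : ℕ) [Fact p.Prime], (p : ℤ) ∣ b →
          ¬ (⟨1, 0, 0, 0, (b : ℚ)⟩ : WeierstrassCurve ℚ).HasGoodReductionAtPrime p :=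
  Theorems.TamePinchR.Negative.family_inhabits_binder b hb h2

/-! ## 3. Refuted natural strengthenings (c): the pinch prime cannot be bounded, let alone uniform
(landed: `Theorems/TamePinchR/Negative/PinchPrimeUnbounded.lean`, p130969) -/

/-- **STRENGTHENING REFUTED: a bounded pinch prime.** For every bound `B` the statement
"every non-CM globally minimal elliptic `W` has an admissible certificate prime `p ≤ B`" is false:
`W_{2·B!}` is elliptic, globally minimal, non-CM, and bad at every prime `p ≤ B`. The `∃ p` of
`TamePinchR` must depend on the bad primes of `W` — there is no absolute search bound. [folklore] -/
theorem not_tamePinchR_bounded (B : ℕ) :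
    ¬ ∀ (W : WeierstrassCurve ℚ) [W.IsElliptic] [W.IsGloballyMinimal], ¬ W.HasCM →
      ∃ (p : ℕ) (_ : Fact p.Prime), p ≤ B ∧ 5 ≤ p ∧ Certificate W p :=
  Theorems.TamePinchR.Negative.not_tamePinchR_bounded B

/-- **STRENGTHENING REFUTED: a uniform pinch prime (`∃ p ∀ W`).** No single prime `p ≥ 5` serves
every non-CM curve (`W_{2·p!}` is bad at `p`). [folklore] -/
theorem not_tamePinchR_uniform :
    ¬ ∃ (p : ℕ) (_ : Fact p.Prime), 5 ≤ p ∧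
      ∀ (W : WeierstrassCurve ℚ) [W.IsElliptic] [W.IsGloballyMinimal], ¬ W.HasCM → Certificate W p :=
  Theorems.TamePinchR.Negative.not_tamePinchR_uniform

/-! ## 4. Targets / the picked line `Sketch` — refuter pass over the stubs

`payload.targets = []`, `payload.stuck_stubs = []` in cycle 1 (nothing is stuck yet). The lead
(`prover-line-stmt-BirchSwinnertonDyer-17007-0`) published `Lines/Sketch.lean` (2026-08-16T23:09Z):
`tamePinchR_of_shaFinite (hSha : ShaFiniteConjecture) : TamePinchR` from six stubs — **M** (modular
parametrisation datum, tree fact `nonempty_modularParametrizationData` verbatim, literature), **K**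
(`Kim2022_kuriharaNumber_certificate`, Kim 2022 Thm 1.11, literature), **A** (admissible
non-anomalous prime supply off any finite set, for non-CM `W`), **B** (finite `Ш` ⇒ `Ш[p] = 0`
cofinitely), **C** (`E(ℚ_p)[p] = 0` at a good non-anomalous `p ≥ 5`), **D** (Manin constant and the
period ratio `Ω(W)/Ω⁺_f` are `p`-units cofinitely). JOINT SUFFICIENCY is kernel-checked (the
composition is sorry-free given the stubs) and is exactly the upper slice of the sandwich in the module
docstring: the line delivers `ShaFiniteConjecture ⇒ TamePinchR` and can never be unconditional (stub
B consumes the open conjecture; nothing else in the line is conjectural once K is granted as print).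

Per-stub refuter verdict (degenerate cases · typing against print · known counterexamples):

* **A** `stub_admissibleSupply` — TRUE in print and provable from the tree: `serre_open_image_holds`
  (surjective for `p ≫ 0`, needs `¬ W.HasCM` — load-bearing, §1: 32a2 has no surjective odd prime),
  finiteness of the bad primes, and a supply of `p` with `a_p ∉ {0, 1}` (Chebotarev at one auxiliary
  surjective prime `q ≥ 5`: Frobenius classes with trace `≡ 2 (mod q)` have positive density, and
  `a_p ≡ 2 (mod q)` excludes `a_p ∈ {0,1}`; for `p ≥ 7` Hasse turns `a_p ≢ 0, 1 (mod p)` into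
  `a_p ∉ {0, 1}`). The `∀ S finite` shape is forced (§3: no bound on `p` exists). Not attackable.
* **B** `stub_shaTorsionCofinite` — TRUE (Lagrange; `S` = prime factors of `#Ш`). Trivial.
* **C** `stub_localTorsionTrivial` — TRUE: `E₁(ℚ_p)` is torsion-free for `p ≥ 3` and
  `Ẽ(𝔽_p)[p] = 0 ⟺ p ∤ #Ẽ(𝔽_p) = p + 1 − a_p ⟺ a_p ≢ 1 (mod p)`; the hypotheses (`5 ≤ p`, good
  reduction, `¬ p ∣ a_p − 1`, points of the globally minimal `W` over `ℚ_p`) are exactly right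
  (at `p = 5`, `a_5 = −4` is correctly treated as anomalous: `#Ẽ(𝔽_5) = 10`).
* **D** `stub_maninPeriodCofinite` — TRUE from tree `realPeriodRat_dvd_holds`
  (`m·Ω(W) = |c|·Ω⁺_f`, `m > 0`) and `maninConstant_ne_zero_holds`: `S` = prime factors of `|c|·m`,
  `u = |c|/m`.
* **K** `Kim2022_kuriharaNumber_certificate` — FAITHFUL to print (re-read from the materialised text):
  hypotheses = Thm 1.11 (i)–(iv) + `Ш[p] = 0` (PDF p. 8); Kolyvagin primes = Kim's
  `𝒫₁ = {ℓ : (ℓ, Np) = 1, ℓ ≡ 1, a_ℓ ≡ ℓ + 1 (mod p)}` (p. 5), NO cyclicity condition — exactly the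
  crux's three conjuncts; conclusion `ν(n) = rank` is the "mod p exact rank formula"; statement (3) =
  IMC is a theorem at good ORDINARY `p ≥ 5` with `ρ̄` onto (p. 4: Kato + Skinner–Urban + Wan — the
  `q ∥ N` proviso of Skinner–Urban is gone after Wan), so the restriction to `IsOrdinaryAt` is what
  makes K literature rather than conjecture (at supersingular `p` it would be conjecture-grade). The
  normalisation hypothesis (`Ω(W) = u·Ω⁺_f`, `u` a `p`-unit) correctly converts Kim's Néron-normalised
  `[r]⁺ = re{∞,r}_f/Ω⁺_E` (§1.4.1) into the tree's `ratPlusSymbol f r = re{∞,r}_f/Ω⁺_f`. K is a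
  FIXED-`p` statement and is true only BECAUSE it carries `Ш[p] = 0`, `p ∤ Tam`, `a_p ≢ 1`: 1058.e1
  at `p = 5` (§5) violates precisely `Ш[5] = 0`. Do not weaken any of the three.
* **M** — the tree's named fact verbatim; literature (BCDT 2001 + Edixhoven 1991).

No stub is false, vacuous or misstated; no `<stub>_false` theorem is possible; the Targets list stays
empty.

NUMERICS (PARI/GP 2.15.4 `msfromell`/`mseval`, this seat; kit j020795 = run 1, j020943 = run 2,
j021039 = run 3; evidence `compute-j02….json` + `scan-j020943.txt`, `scan-j021039.txt` on the item):
* PARI's plus symbol is Néron-normalised per curve (`x⁺{∞→0} = L(E,1)/ω₁`: 11a1 `1/5`, 11a2 `1`,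
  11a3 `1/25`), i.e. Kim's convention; 37a1 @ 5 and 389a1 @ 5 reproduce the crux-attack seat's
  (j020465) and Kim §8's values exactly (see §5).
* 1058.e1 @ 5 (the fixed-prime counterexample of §5) with ALL admissibility data checked:
  `N = 2·23²`, Tamagawa product `1`, torsion `1`, `w = +1`, `a_5 = 2` (good, ordinary,
  non-anomalous), `ρ̄_5` onto CERTIFIED (Serre 1972 Prop. 19 criterion from Frobenius data
  `ℓ ≤ 2000`; also onto at `7` and `11`), isogeny class trivial (`ellisomat` degrees `(1)`, so the
  curve is optimal and the `Ω⁺_f`-normalisation differs from Néron's only by the Manin constant,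
  prime to `5`), analytic rank `0`, `L(E,1)/Ω = 25.000…`, `[0]⁺ = 25`: the rank-0 certificate
  `δ₁` is `≡ 0 (mod 5)` but `≡ 4 (mod 7)`, `≡ 3 (mod 11)` — the crux HOLDS at this curve with
  `p = 7`, only its fixed-prime form fails at `p = 5` (exactly where `Ш[5^∞] ≅ (ℤ/5)²`).
* CERTIFICATE SCAN (run 2): all non-CM curves `[a₁,…,a₆]` with `a₁,a₃ ∈ {0,1}`, `|a₂| ≤ 1`,
  `|a₄| ≤ 12`, `|a₆| ≤ 16`, root number `+1`, 2-descent rank `≥ 2` (PARI `ellrank`), analytic rank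
  `2`, conductor `≤ 1500`: 32 isogeny classes (conductors 389, 433, 446, 571, 643, 664, 681, 707,
  709, 718, 794, 817, 916, 997, 1028, 1034, 1058, 1070, 1094, 1126, 1132, 1137, 1147, 1171, 1246,
  1324, 1325, 1436, 1443, 1446, 1477, 1483; `ellrank` gives `[2,2]`, i.e. Mordell–Weil rank EXACTLY
  2, for all 32). For every class an admissible prime `p ∈ {5, 7}` exists below 60 (good ordinary
  non-anomalous, `p ∤ Tam`, `ρ̄_p` onto certified). With the tiny search bounds of run 2 (Kolyvagin
  primes `ℓ < 400`, at most 6 pairs `n = ℓ₁ℓ₂`) a certificate `δ_n ≢ 0 (mod p)` at the LEAST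
  admissible `p` was found for 24/32 (e.g. 389: `δ_{41·61} ≡ 4 (mod 5)`; 433 = `[1,0,0,0,1]`, the
  `b = 1` member of the §2 family: `p = 7`, `δ_{29·113} ≡ 3`; 1058.? `[1,0,1,0,2]`: `δ_{131·151} ≡ 2
  (mod 5)`); 4/32 (664, 681, 1028, 1070) had fewer than two Kolyvagin primes below 400 (nothing to
  try); 4/32 (817: `31·61`; 1034: `71·251`; 1094: `11·131, 11·181, 131·181`; 1446: all six pairs
  from `61, 131, 191, 211`) had every tried pair vanish — INCONCLUSIVE at this bound, as Kim's
  Prop. (vanishing of `δ_n`, §3.5) predicts whenever the localisation `Sel_5 → ⊕_{ℓ∣n} E(𝔽_ℓ)/5`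
  fails to be an isomorphism. Follow-up run 3 = kit j021039 (`ℓ < 3000`, up to 40 pairs, recording
  the `p`-part of `E(𝔽_ℓ)` at each Kolyvagin prime) CERTIFIED ALL 8: 664 `δ_{127·743} ≡ 6 (mod 7)`,
  681 `δ_{1163·1667} ≡ 2 (mod 7)`, 817 `δ_{31·401} ≡ 4`, 1028 `δ_{281·953} ≡ 3 (mod 7)`, 1034
  `δ_{71·491} ≡ 2`, 1070 `δ_{337·463} ≡ 6 (mod 7)`, 1094 `δ_{11·401} ≡ 4`, 1446 `δ_{61·491} ≡ 4
  (mod 5)` — the last only at the 16th pair: all fifteen pairs from `61, 131, 191, 211, 271, 461`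
  vanish (`271` and `601` have FULL `5`-torsion `E(𝔽_ℓ)[5] ≅ (ℤ/5)²`, the others are cyclic), a
  concrete picture of how sparse the non-vanishing levels can be even when `Ш[p] = 0`.
  FINAL COUNT: 32/32 non-CM Mordell–Weil-rank-2 classes of conductor `≤ 1483` in the box carry the
  crux's certificate at their LEAST admissible prime (`p = 5` or `7`), with `ν(n) = 2 = rank` and
  `n = ℓ₁ℓ₂ < 2·10⁶`. NO COUNTEREXAMPLE, and none in sight: a fixed-`p` failure would need ALL
  levels to vanish (and would still only refute the `∀ p` form of §5, not the crux).
-/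

/-! ## 5. Near-misses (NOT closable in Lean; `sorry` by design, see the module docstring) -/

/-- NEAR-MISS — **the fixed-prime (`∀ admissible p`) form of the crux is false in print**, witness
1058.e1 = `y² + xy = x³ − x² − 332311x − 73733731` at `p = 5` (C.-H. Kim, arXiv:2203.12159 §8,
PDF p. 34): `5` is good (`1058 = 2·23²`), ordinary and non-anomalous (`a_5 = 2`: four points mod 5,
hand count; confirmed by PARI, kit j020943), `ρ̄_{E,5}` onto (Kim applies Thm 1.1 there; CERTIFIED
numerically by Serre's Prop. 19 criterion, kit j020943), Tamagawa product `1`, torsion `1`, isogeny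
class trivial, `rank = 0` (analytic rank `0`, `L(E,1)/Ω = 25.000…`) so the only admissible level is
`n = 1` and the certificate reads `([0]⁺ : ZMod 5) ≠ 0`; but `δ₁ = [0]⁺ = L(E,1)/Ω⁺_E = 25 ≡ 0
(mod 5)` — indeed `Ш(E)[5^∞] ≅ (ℤ/5)²` and `ord δ̃ = 2 > 0 = rank` — while `δ₁ ≡ 4 (mod 7)` and
`≡ 3 (mod 11)` at the admissible primes `7, 11`: the crux itself holds here with `p = 7`.
(The tree normalises `[0]⁺` by `Ω⁺_f`; the curve being alone in its isogeny class, the ratio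
`Ω⁺_f/Ω⁺_E` is the Manin constant up to sign, prime to the good odd prime `5`.) OBSTRUCTION to a Lean proof: no evaluator for
`ratPlusSymbol f 0`, `mordellWeilRank`, and no way to PROVE `HasSurjectiveModNGaloisRep 5` for an
explicit curve with the present API. Consequence for the line: `p` must be chosen AFTER the finite
set `{p ∣ #Ш_an·Tam}` is known to be avoidable — i.e. the Ш-supply stub is essential, not
cosmetic. [cite: Kim2022StructureSelmer, §8 (PDF p. 34)] -/
theorem not_tamePinchR_fixedPrime :
    ¬ ∀ (W : WeierstrassCurve ℚ) [W.IsElliptic] [W.IsGloballyMinimal], ¬ W.HasCM →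
      ∀ (p : ℕ) [Fact p.Prime], 5 ≤ p → Literature.NumberTheory.EllipticCurves.IsOrdinaryAt W p →
        W.HasSurjectiveModNGaloisRep (p : ℤ) → Certificate W p := by
  sorry

/-- NEAR-MISS — **the `∀ n` form is false** (not every square-free product of `rank`-many
Kolyvagin primes certifies): 37a1 = `[0,0,1,−1,0]` (rank 1, non-CM — `Negative.not_hasCM_thirtySevenA1`),
`p = 5` (admissible): `δ_61 ≡ 1`, `δ_281 ≡ 1`, `δ_491 ≡ 2` but `δ_211 ≡ 0 (mod 5)` although `211`
is a Kolyvagin prime (kit job j020465 of seat refuter-rattack-stmt-BirchSwinnertonDyer-17007-0, sum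
in the exact shape of the crux; independently RECOMPUTED by this seat with PARI/GP modular symbols,
kit j020795: `a_5 = −2`, `ρ̄_5` onto certified by Serre's Prop. 19 criterion from Frobenius data
`ℓ ≤ 3000`, Kolyvagin primes `≤ 600` for `p = 5`: `61, 211, 281, 491, 521, 571`,
`δ_61 ≡ 1, δ_211 ≡ 0, δ_281 ≡ 1 (mod 5)` — same values; and for 389a1 (rank 2) at `p = 5`:
`a_5 = −3`, `ρ̄_5` onto, Kolyvagin primes `41, 61, 131, 211, 251, 271, 571`, `δ_{41·61} ≡ 4 ≠ 0`
(Kim §8's certificate), `δ_41 ≡ 0` (single level, killed by the functional equation)). Theory: `δ_ℓ ≡ 0` whenever the Mordell–Weil generator reduces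
into `p·Ẽ(𝔽_ℓ)` (Kim 2022 Prop. "vanishing of `δ_n`" / Kurihara 2014), which happens for a
positive density of Kolyvagin `ℓ` at EVERY `p` (Chebotarev in `ℚ(E[p], p⁻¹P)`), so no choice of
`p` rescues the `∀ n` form. OBSTRUCTION to a Lean proof: as above (no symbol evaluator, no
surjectivity proof). Consequence for the line: the level `n` must be CHOSEN (tame card: by a unit
localisation determinant), never universally quantified. [cite: Kim2022StructureSelmer, §8 (PDF p. 34)] -/
theorem not_tamePinchR_forallLevels :
    ¬ ∀ (W : WeierstrassCurve ℚ) [W.IsElliptic] [W.IsGloballyMinimal], ¬ W.HasCM →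
      ∃ (p : ℕ) (_ : Fact p.Prime), 5 ≤ p ∧
        Literature.NumberTheory.EllipticCurves.IsOrdinaryAt W p ∧ W.HasSurjectiveModNGaloisRep (p : ℤ) ∧
        ∃ (N : ℕ) (_ : NeZero N) (f : CuspForm (CongruenceSubgroup.Gamma0 N) 2),
          Literature.NumberTheory.EllipticCurves.ModularForms.IsNewformOf W f ∧
          ∀ (n : ℕ) [NeZero n], Squarefree n → n.primeFactors.card = W.mordellWeilRank →
            (∀ ℓ ∈ n.primeFactors, ¬ ℓ ∣ N * p ∧ (ℓ : ZMod p) = 1 ∧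
              (W.frobeniusTrace ℓ : ZMod p) = 2) →
            ∃ ψ : (ℓ : ℕ) → (ZMod ℓ)ˣ →* Multiplicative (ZMod p),
              (∀ ℓ ∈ n.primeFactors, Function.Surjective (ψ ℓ)) ∧
              (∑ a : (ZMod n)ˣ, (Literature.NumberTheory.EllipticCurves.ratPlusSymbol f
                  (((a : ZMod n).val : ℚ) / n) : ZMod p) *
                ∏ ℓ ∈ n.primeFactors.attach, Multiplicative.toAdd
                  (ψ ℓ.1 (ZMod.unitsMap (Nat.dvd_of_mem_primeFactors ℓ.2) a))) ≠ 0 := by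
  sorry

end Summit.BirchSwinnertonDyer.BirchSwinnertonDyer.Cruxes.TamePinchR.Disproof

end
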